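import Summits.QuantumAdvantage.QuantumAdvantage.Theorems.SteerDialTagLaw

/-!
# SteerDial (10): SteerDialLocal — rotation lists cover every dense LOCAL test (first rung of the covering residual, PROVED)

Part 10 of the prover-side twin of the lineage decomp-qadv-lens-5 steering programme, generation 9, workshop node
«TagDial» rev 2 §6.  `steerDial_localNoSat3`: the rotation-list covering statement (workshop `AdaptiveNoSat3`, the
hypothesis of `steerDial_algCover3_of_adaptiveNoSat3`) restricted to LOCAL tests — tests reading only the pad window
and one body arc `[a, a+Λ)` with `Λ·k'(log₂ n+1) ≤ n` — HOLDS (`η = 1/128`, `m = 6`, word `W0`, rotations `tΛ`,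
`T = k'(log₂ n+1)`): junta events on pairwise disjoint shifted arcs are independent (exact product formula
`card_forall_junta` via the merge bijection `card_inter_mul_of_depOn`), each failure event has mass `≤ 1/2`, so
`#Bad ≤ 2ⁿ/2^T ≤ 2ⁿ/n^{k'}`.  `tagTest_local`: the tag tests of part 9 (which refute every FIXED window list) are local,
hence covered.  SUPPORTS item stmt-QuantumAdvantage-30909 (first rung of its residual).  No `def … : Prop`, no
`instance`, no `notation`.
-/

set_option linter.style.longLine false
set_option linter.dupNamespace false

namespace Summit.QuantumAdvantage.QuantumAdvantage.Theorems.SteerDial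

open Finset
open Literature.Computability.QuantumComplexity Literature.Computability.MetaComplexity
open Literature.Computability.QuantumComplexity.RingHLF
open Summit.QuantumAdvantage.AdviceFreeQNC0
open Summit.QuantumAdvantage.QuantumAdvantage.Theses

/-! ## Rotation lists cover every dense LOCAL test

The tag adversary of §4 kills every FIXED window list; here we prove that ROTATION lists cover it — and every other LOCAL
test (a test reading only the pad window and a body arc of length `Λ` with `Λ·T ≤ n`): word `W0` for every candidate,
rotations `rₜ = t·Λ`, `T = k'(log₂ n + 1)`.  The read-supports of the `T` candidates are pairwise disjoint arcs, so the
`T` failure events are INDEPENDENT junta events (exact product formula `card_forall_junta`, proved by the merge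
bijection), each of mass `≤ 1/2` (`η = 1/128`), whence `#Bad = 2ⁿ·(#B/2ⁿ)^T ≤ 2ⁿ/2^T ≤ 2ⁿ/n^{k'}`. -/

section Junta

variable {N : ℕ}

/-- Merge of two cube points: `y` on `U`, `y'` off `U`.  (A `U`-JUNTA EVENT `C` is one with
`∀ y y', (∀ i ∈ U, y i = y' i) → (y ∈ C ↔ y' ∈ C)`; the hypothesis is spelled out in each statement.) -/
def merge (U : Finset (Fin N)) (y y' : Fin N → Bool) : Fin N → Bool :=
  fun i => if i ∈ U then y i else y' i

/-- **Product formula for two junta events on disjoint supports**: `#(A ∩ C)·2^N = #A·#C`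
(the merge bijection `(y″, w) ↦ (merge y″ w, merge w y″)` between `(A ∩ C) × cube` and `A × C`). -/
theorem card_inter_mul_of_depOn {U S : Finset (Fin N)} {A C : Finset (Fin N → Bool)}
    (hA : ∀ y y' : Fin N → Bool, (∀ i ∈ U, y i = y' i) → (y ∈ A ↔ y' ∈ A))
    (hC : ∀ y y' : Fin N → Bool, (∀ i ∈ S, y i = y' i) → (y ∈ C ↔ y' ∈ C)) (hUS : Disjoint U S) :
    (A ∩ C).card * 2 ^ N = A.card * C.card := by
  classical
  have hoff : ∀ i ∈ S, i ∉ U := fun i hi hiU => disjoint_left.1 hUS hiU hi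
  have key : ((A ∩ C) ×ˢ (univ : Finset (Fin N → Bool))).card = (A ×ˢ C).card := by
    refine Finset.card_nbij' (fun p => (merge U p.1 p.2, merge U p.2 p.1)) (fun q => (merge U q.1 q.2, merge U q.2 q.1))
      ?_ ?_ ?_ ?_
    · rintro ⟨y'', w⟩ hp
      simp only [mem_coe, mem_product, mem_inter, mem_univ, and_true] at hp ⊢
      refine ⟨(hA (merge U y'' w) y'' fun i hi => by simp [merge, hi]).2 hp.1,
        (hC (merge U w y'') y'' fun i hi => by simp [merge, hoff i hi]).2 hp.2⟩
    · rintro ⟨y, y'⟩ hq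
      simp only [mem_coe, mem_product, mem_inter, mem_univ, and_true] at hq ⊢
      exact ⟨(hA (merge U y y') y fun i hi => by simp [merge, hi]).2 hq.1,
        (hC (merge U y y') y' fun i hi => by simp [merge, hoff i hi]).2 hq.2⟩
    · rintro ⟨y'', w⟩ _
      refine Prod.ext (funext fun i => ?_) (funext fun i => ?_) <;> by_cases hi : i ∈ U <;> simp [merge, hi]
    · rintro ⟨y, y'⟩ _
      refine Prod.ext (funext fun i => ?_) (funext fun i => ?_) <;> by_cases hi : i ∈ U <;> simp [merge, hi]
  have h2 : (univ : Finset (Fin N → Bool)).card = 2 ^ N := by simp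
  rw [card_product, card_product, h2] at key
  exact key

/-- **Product formula for `T` junta events on pairwise disjoint supports, all of the same size `K`**:
`#{y : ∀ t, y ∈ Cₜ}·(2^N)^T = 2^N·K^T`. -/
theorem card_forall_junta {T : ℕ} (C : Fin T → Finset (Fin N → Bool)) (U : Fin T → Finset (Fin N)) (K : ℕ)
    (hC : ∀ t, ∀ y y' : Fin N → Bool, (∀ i ∈ U t, y i = y' i) → (y ∈ C t ↔ y' ∈ C t)) (hK : ∀ t, (C t).card = K)
    (hU : ∀ s t : Fin T, s ≠ t → Disjoint (U s) (U t)) :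
    (univ.filter fun y : Fin N → Bool => ∀ t : Fin T, y ∈ C t).card * (2 ^ N) ^ T = 2 ^ N * K ^ T := by
  classical
  -- partial intersections `P j = {y : ∀ t, t < j → y ∈ C t}` with supports `V j`
  set P : ℕ → Finset (Fin N → Bool) := fun j => univ.filter fun y => ∀ t : Fin T, t.val < j → y ∈ C t with hP_def
  set V : ℕ → Finset (Fin N) := fun j => univ.filter fun i => ∃ t : Fin T, t.val < j ∧ i ∈ U t with hV_def
  have hPdep : ∀ j, ∀ y y' : Fin N → Bool, (∀ i ∈ V j, y i = y' i) → (y ∈ P j ↔ y' ∈ P j) := by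
    intro j y y' hy
    simp only [hP_def, mem_filter, mem_univ, true_and]
    refine forall_congr' fun t => imp_congr_right fun ht => hC t y y' fun i hi => hy i ?_
    simp only [hV_def, mem_filter, mem_univ, true_and]
    exact ⟨t, ht, hi⟩
  have hstep : ∀ j, j < T → (P (j + 1)).card * 2 ^ N = (P j).card * K := by
    intro j hj
    set t₀ : Fin T := ⟨j, hj⟩
    have hPsucc : P (j + 1) = P j ∩ C t₀ := by
      ext y
      simp only [hP_def, mem_filter, mem_univ, true_and, mem_inter]
      constructor
      · intro h
        exact ⟨fun t ht => h t (by omega), h t₀ (by simp [t₀])⟩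
      · rintro ⟨h, h0⟩ t ht
        rcases Nat.lt_succ_iff_lt_or_eq.1 ht with ht' | ht'
        · exact h t ht'
        · have : t = t₀ := Fin.ext (by simp [t₀, ht'])
          rw [this]; exact h0
    have hdisj : Disjoint (V j) (U t₀) := by
      rw [Finset.disjoint_left]
      intro i hi hi0
      simp only [hV_def, mem_filter, mem_univ, true_and] at hi
      obtain ⟨t, ht, hit⟩ := hi
      have hne : t ≠ t₀ := by intro h; rw [h] at ht; simp [t₀] at ht
      exact disjoint_left.1 (hU t t₀ hne) hit hi0
    rw [hPsucc, card_inter_mul_of_depOn (hPdep j) (hC t₀) hdisj, hK t₀]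
  have hind : ∀ j, j ≤ T → (P j).card * (2 ^ N) ^ j = 2 ^ N * K ^ j := by
    intro j
    induction j with
    | zero =>
      intro _
      have : P 0 = univ := by ext y; simp [hP_def]
      rw [this]; simp
    | succ j ih =>
      intro hj
      have h1 := hstep j (by omega)
      have h2 := ih (by omega)
      calc (P (j + 1)).card * (2 ^ N) ^ (j + 1) = (P (j + 1)).card * 2 ^ N * (2 ^ N) ^ j := by ring
        _ = (P j).card * K * (2 ^ N) ^ j := by rw [h1]
        _ = K * ((P j).card * (2 ^ N) ^ j) := by ring
        _ = K * (2 ^ N * K ^ j) := by rw [h2]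
        _ = 2 ^ N * K ^ (j + 1) := by ring
  have hPT : P T = univ.filter fun y : Fin N → Bool => ∀ t : Fin T, y ∈ C t := by
    ext y; simp only [hP_def, mem_filter, mem_univ, true_and]
    exact ⟨fun h t => h t t.isLt, fun h t _ => h t⟩
  rw [← hPT]; exact hind T le_rfl

end Junta

section Local

variable {n : ℕ}

/-- SteerDial helper `rinv_rot` (lens-5 g7 SteerDial twin; see the enclosing section docstring). -/
theorem rinv_rot (r : ℕ) (y : Fin n → Bool) : rot (rinv n r) (rot r y) = y := by
  rw [RingSymmetry.rot_rot, add_comm, ← RingSymmetry.rot_rot]; exact rot_rinv r y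

/-- Rotation preimages preserve cardinality: `#{y : rot r y ∈ B} = #B`. -/
theorem card_filter_rot_mem (r : ℕ) (B : Finset (Fin n → Bool)) :
    (univ.filter fun y : Fin n → Bool => rot r y ∈ B).card = B.card := by
  classical
  have : (univ.filter fun y : Fin n → Bool => rot r y ∈ B) = B.image (rot (rinv n r)) := by
    ext y
    simp only [mem_filter, mem_univ, true_and, mem_image]
    constructor
    · intro h; exact ⟨rot r y, h, rinv_rot r y⟩
    · rintro ⟨z, hz, rfl⟩; rw [rot_rinv]; exact hz
  rw [this, card_image_of_injective _ (RingSymmetry.rot_injective _)]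

/-- The body arc `[a, a+Λ)` as a set of ring positions. -/
def arc (n a Λ : ℕ) : Finset (Fin n) := univ.filter fun b : Fin n => a ≤ b.val ∧ b.val < a + Λ

/-- Read-supports of distinct candidates are disjoint: the arcs `[a, a+Λ) + sΛ` and `[a, a+Λ) + tΛ` (`s ≠ t < T`,
`T·Λ ≤ n`) do not meet modulo `n`. -/
theorem disjoint_arc_shift {a Λ T : ℕ} (hTΛ : T * Λ ≤ n) (s t : Fin T) (hst : s ≠ t) :
    Disjoint ((arc n a Λ).image (RingSymmetry.shift n (s.val * Λ)))
      ((arc n a Λ).image (RingSymmetry.shift n (t.val * Λ))) := by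
  classical
  -- w.l.o.g. by symmetry prove: no common element
  rw [Finset.disjoint_left]
  rintro i hs ht
  simp only [mem_image, arc, mem_filter, mem_univ, true_and] at hs ht
  obtain ⟨b, ⟨hb1, hb2⟩, hbi⟩ := hs
  obtain ⟨b', ⟨hb1', hb2'⟩, hbi'⟩ := ht
  have hmod : (b.val + s.val * Λ) % n = (b'.val + t.val * Λ) % n := by
    have h1 := congrArg Fin.val hbi; have h2 := congrArg Fin.val hbi'
    simp only [RingSymmetry.shift] at h1 h2
    omega
  -- the two un-reduced positions differ by a positive amount `< n`
  have key : ∀ (p q : ℕ) (x y : ℕ), p < q → q < T → a ≤ x → x < a + Λ → a ≤ y → y < a + Λ →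
      (x + p * Λ) % n ≠ (y + q * Λ) % n := by
    intro p q x y hpq hq hx1 hx2 hy1 hy2 heq
    have hl1 : p * Λ + Λ ≤ q * Λ := by
      have := Nat.mul_le_mul_right Λ (show p + 1 ≤ q by omega); simpa [Nat.add_mul] using this
    have hl2 : q * Λ + Λ ≤ T * Λ := by
      have := Nat.mul_le_mul_right Λ (show q + 1 ≤ T by omega); simpa [Nat.add_mul] using this
    generalize hP : p * Λ = pL at hl1 heq
    generalize hQ : q * Λ = qL at hl1 hl2 heq
    generalize hTT : T * Λ = TL at hl2 hTΛ
    have hlt : x + pL < y + qL := by omega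
    have hlt' : y + qL < x + pL + n := by omega
    have hdvd : n ∣ (y + qL) - (x + pL) := by
      have := Nat.sub_mod_eq_zero_of_mod_eq heq.symm
      exact Nat.dvd_of_mod_eq_zero this
    have hpos : 0 < (y + qL) - (x + pL) := by omega
    have hle := Nat.le_of_dvd hpos hdvd
    omega
  rcases lt_or_gt_of_ne (fun h : s.val = t.val => hst (Fin.ext h)) with h | h
  · exact key s.val t.val b.val b'.val h t.isLt hb1 hb2 hb1' hb2' hmod
  · exact key t.val s.val b'.val b.val h s.isLt hb1' hb2' hb1 hb2 hmod.symm

/-- The failure event of candidate `t` (word `W0`, rotation `tΛ`) for a test `ψ` reading only the window and the body arc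
`[a, a+Λ)` is a junta event on the shifted arc. -/
theorem depOn_fail {a Λ : ℕ} (ψ : Smolensky.CubeFn (ZMod 3) (n + 6))
    (hloc : ∀ x x' : Fin (n + 6) → Bool,
      (∀ i : Fin (n + 6), (a ≤ i.val ∧ i.val < a + Λ) ∨ n ≤ i.val → x i = x' i) → ψ x = ψ x')
    (r : ℕ) :
    ∀ y y' : Fin n → Bool, (∀ i ∈ (arc n a Λ).image (RingSymmetry.shift n r), y i = y' i) →
      (y ∈ (univ.filter fun y : Fin n → Bool => ψ (pad W0 (rot r y)) ≠ 1) ↔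
        y' ∈ (univ.filter fun y : Fin n → Bool => ψ (pad W0 (rot r y)) ≠ 1)) := by
  classical
  intro y y' hy
  simp only [mem_filter, mem_univ, true_and]
  have : ψ (pad W0 (rot r y)) = ψ (pad W0 (rot r y')) := by
    apply hloc
    intro i hi
    induction i using Fin.addCases with
    | left b =>
      rw [pad_castAdd, pad_castAdd, RingSymmetry.rot_apply, RingSymmetry.rot_apply]
      apply hy
      rcases hi with hi | hi
      · exact mem_image.2 ⟨b, by simpa [arc] using hi, rfl⟩
      · exact absurd hi (by simp)
    | right j => rw [pad_natAdd, pad_natAdd]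
  rw [this]

/-- **THE LOCAL-TEST RUNG (PROVED).**  `AdaptiveNoSat3` restricted to LOCAL tests — tests reading only the pad window
and a body arc `[a, a+Λ)` with `Λ·k'(log₂ n + 1) ≤ n` — holds, with `η = 1/128`, `m = 6`, `c₁ = 2`, word `W0` for every
candidate and rotations `rₜ = tΛ`, `T = k'(log₂ n + 1)`.  In particular the tag tests of §4 (arc `[n−L, n)`), which refute
every FIXED window list, ARE covered by rotation lists. -/
theorem steerDial_localNoSat3 : ∃ η : ℝ, 0 < η ∧ ∀ k' : ℕ, ∃ m : ℕ, 1 ≤ m ∧ ∃ c₁ : ℕ, ∀ c : ℕ, ∃ n₀ : ℕ, ∀ n ≥ n₀,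
    ∀ ψ : Smolensky.CubeFn (ZMod 3) (n + m), ψ ∈ Smolensky.lowDeg (ZMod 3) (n + m) ((Nat.log 2 (n + m)) ^ c) →
      (∃ a Λ : ℕ, Λ * (k' * (Nat.log 2 n + 1)) ≤ n ∧
          ∀ x x' : Fin (n + m) → Bool,
            (∀ i : Fin (n + m), (a ≤ i.val ∧ i.val < a + Λ) ∨ n ≤ i.val → x i = x' i) → ψ x = ψ x') →
      (1 - η) * (2 : ℝ) ^ (n + m) ≤ ((univ.filter fun x : Fin (n + m) → Bool => ψ x = 1).card : ℝ) →
        ∃ T : ℕ, T ≤ (Nat.log 2 n) ^ c₁ ∧ ∃ r : Fin T → ℕ, ∃ u α β : Fin T → Fin m → Bool, ∃ a b : Fin T → Bool,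
          (∀ t, wordCert (u t) (α t) (β t) (a t) (b t) = true) ∧
          ((univ.filter fun y : Fin n → Bool => ∀ t : Fin T, ψ (pad (u t) (rot (r t) y)) ≠ 1).card : ℝ) ≤
            1 / (n : ℝ) ^ k' * (2 : ℝ) ^ n := by
  classical
  refine ⟨1 / 128, by norm_num, fun k' => ⟨6, by norm_num, 2, fun c => ⟨2 ^ (2 * k' + 1), ?_⟩⟩⟩
  intro n hn ψ _ hloc hE
  obtain ⟨a₀, Λ, hΛ, hloc⟩ := hloc
  set L := Nat.log 2 n with hL
  set T := k' * (L + 1) with hT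
  have hn1 : 1 ≤ n := le_trans Nat.one_le_two_pow hn
  have hLk : 2 * k' + 1 ≤ L := by
    rw [hL]; exact Nat.le_log_of_pow_le (by norm_num) hn
  -- the certificate
  refine ⟨T, ?_, fun t => t.val * Λ, fun _ => W0, fun _ => A0, fun _ => B0, fun _ => false, fun _ => false,
    fun _ => wordCert_W0, ?_⟩
  · -- T = k'(L+1) ≤ k'·2L = (2k')·L ≤ L·L = L^2
    calc T = k' * (L + 1) := hT
      _ ≤ k' * (2 * L) := Nat.mul_le_mul_left _ (by omega)
      _ = (2 * k') * L := by ring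
      _ ≤ L * L := Nat.mul_le_mul_right _ (by omega)
      _ = L ^ 2 := (sq L).symm
  have hTΛ : T * Λ ≤ n := by
    calc T * Λ = Λ * (k' * (L + 1)) := by rw [hT, mul_comm]
      _ ≤ n := hΛ
  -- the body-bad set of the word W0 and the failure events
  set B : Finset (Fin n → Bool) := univ.filter fun z : Fin n → Bool => ψ (pad W0 z) ≠ 1 with hB
  set C : Fin T → Finset (Fin n → Bool) := fun t => univ.filter fun y : Fin n → Bool => ψ (pad W0 (rot (t.val * Λ) y)) ≠ 1
    with hC
  have hCK : ∀ t, (C t).card = B.card := by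
    intro t
    have : C t = univ.filter fun y : Fin n → Bool => rot (t.val * Λ) y ∈ B := by
      ext y; simp [hC, hB]
    rw [this, card_filter_rot_mem]
  have hprod := card_forall_junta C (fun t => (arc n a₀ Λ).image (RingSymmetry.shift n (t.val * Λ))) B.card
    (fun t => depOn_fail ψ hloc (t.val * Λ)) hCK
    (fun s t hst => disjoint_arc_shift hTΛ s t hst)
  have hBad : (univ.filter fun y : Fin n → Bool => ∀ t : Fin T, ψ (pad W0 (rot (t.val * Λ) y)) ≠ 1) =
      (univ.filter fun y : Fin n → Bool => ∀ t : Fin T, y ∈ C t) := by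
    ext y; simp [hC]
  rw [hBad]
  set Bad := univ.filter fun y : Fin n → Bool => ∀ t : Fin T, y ∈ C t
  -- mass of B: 2·#B ≤ 2^n
  have hBle : (B.card : ℝ) ≤ (2 : ℝ) ^ n / 2 := by
    -- #B ≤ #{x : ψ x ≠ 1} ≤ 2^(n+6) − #E ≤ η·2^(n+6) = 2^n / 2
    have h1 : B.card ≤ (univ.filter fun x : Fin (n + 6) → Bool => ψ x ≠ 1).card := by
      refine Finset.card_le_card_of_injOn (pad W0) (fun z hz => ?_) (fun z _ z' _ hzz => ?_)
      · simp only [hB, mem_coe, mem_filter, mem_univ, true_and] at hz ⊢; exact hz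
      · funext i; have := congrFun hzz (Fin.castAdd 6 i); simpa [pad_castAdd] using this
    have h2 : ((univ.filter fun x : Fin (n + 6) → Bool => ψ x ≠ 1).card : ℝ) =
        (2 : ℝ) ^ (n + 6) - ((univ.filter fun x : Fin (n + 6) → Bool => ψ x = 1).card : ℝ) := by
      have := Finset.card_filter_add_card_filter_not (s := (univ : Finset (Fin (n + 6) → Bool)))
        (fun x => ψ x = 1)
      have hu : (univ : Finset (Fin (n + 6) → Bool)).card = 2 ^ (n + 6) := by simp
      rw [hu] at this
      have := congrArg (fun k : ℕ => (k : ℝ)) this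
      push_cast at this
      linarith
    have h3 : (B.card : ℝ) ≤ (2 : ℝ) ^ (n + 6) - ((univ.filter fun x : Fin (n + 6) → Bool => ψ x = 1).card : ℝ) := by
      rw [← h2]; exact_mod_cast h1
    have h4 : (2 : ℝ) ^ (n + 6) = 2 ^ n * 64 := by rw [pow_add]; norm_num
    rw [h4] at h3 hE
    linarith
  -- #Bad = 2^n (#B/2^n)^T ≤ 2^n / 2^T
  have h2n : (0 : ℝ) < (2 : ℝ) ^ n := by positivity
  have hBadR : (Bad.card : ℝ) * ((2 : ℝ) ^ n) ^ T = (2 : ℝ) ^ n * (B.card : ℝ) ^ T := by exact_mod_cast hprod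
  have hBadle : (Bad.card : ℝ) ≤ (2 : ℝ) ^ n / (2 : ℝ) ^ T := by
    have hpowT : (0 : ℝ) < ((2 : ℝ) ^ n) ^ T := by positivity
    have : (B.card : ℝ) ^ T ≤ ((2 : ℝ) ^ n / 2) ^ T := pow_le_pow_left₀ (by positivity) hBle T
    rw [div_pow] at this
    rw [le_div_iff₀ (by positivity)]
    have h5 : (Bad.card : ℝ) * (2 : ℝ) ^ T * ((2 : ℝ) ^ n) ^ T ≤ (2 : ℝ) ^ n * ((2 : ℝ) ^ n) ^ T := by
      calc (Bad.card : ℝ) * (2 : ℝ) ^ T * ((2 : ℝ) ^ n) ^ T = (2 : ℝ) ^ T * ((Bad.card : ℝ) * ((2 : ℝ) ^ n) ^ T) := by ring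
        _ = (2 : ℝ) ^ T * ((2 : ℝ) ^ n * (B.card : ℝ) ^ T) := by rw [hBadR]
        _ ≤ (2 : ℝ) ^ T * ((2 : ℝ) ^ n * (((2 : ℝ) ^ n) ^ T / (2 : ℝ) ^ T)) := by gcongr
        _ = (2 : ℝ) ^ n * ((2 : ℝ) ^ n) ^ T := by field_simp
    exact le_of_mul_le_mul_right h5 hpowT
  -- 2^T = (2^(L+1))^k' ≥ n^k'
  have hnT : (n : ℝ) ^ k' ≤ (2 : ℝ) ^ T := by
    have hnL : n < 2 ^ (L + 1) := by rw [hL]; exact Nat.lt_pow_succ_log_self (by norm_num) n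
    have : (n : ℝ) ≤ (2 : ℝ) ^ (L + 1) := by exact_mod_cast hnL.le
    calc (n : ℝ) ^ k' ≤ ((2 : ℝ) ^ (L + 1)) ^ k' := pow_le_pow_left₀ (by positivity) this k'
      _ = (2 : ℝ) ^ T := by rw [← pow_mul, hT, mul_comm]
  have hnpos : (0 : ℝ) < (n : ℝ) ^ k' := by
    have : (0 : ℝ) < n := by exact_mod_cast hn1
    positivity
  calc (Bad.card : ℝ) ≤ (2 : ℝ) ^ n / (2 : ℝ) ^ T := hBadle
    _ ≤ (2 : ℝ) ^ n / (n : ℝ) ^ k' := by gcongr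
    _ = 1 / (n : ℝ) ^ k' * (2 : ℝ) ^ n := by ring

/-- The tag test of §4 is LOCAL (arc `[n−L, n)`): the adversary that refutes fixed windows lies inside the proved rung. -/
theorem tagTest_local (L m : ℕ) (x x' : Fin (n + m) → Bool)
    (h : ∀ i : Fin (n + m), (n - L ≤ i.val ∧ i.val < n - L + L) ∨ n ≤ i.val → x i = x' i) :
    tagTest n L m x = tagTest n L m x' := by
  have hb : ∀ i ∈ tagBlock n L m, x i = x' i := fun i hi => by
    simp only [tagBlock, mem_filter, mem_univ, true_and] at hi; exact h i (Or.inl ⟨hi.1, by omega⟩)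
  have hm : Smolensky.mono (ZMod 3) (tagBlock n L m) x = Smolensky.mono (ZMod 3) (tagBlock n L m) x' := by
    rw [Smolensky.mono_apply, Smolensky.mono_apply]
    have hiff : (∀ i ∈ tagBlock n L m, x i = true) ↔ (∀ i ∈ tagBlock n L m, x' i = true) :=
      forall₂_congr fun i hi => by rw [hb i hi]
    simp only [hiff]
  simp only [tagTest, Pi.sub_apply, Pi.one_apply, hm]

end Local

end Summit.QuantumAdvantage.QuantumAdvantage.Theorems.SteerDial
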